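import Summits.QuantumFields.YangMills.Theorems.UnitScaleTiltProp7ClosedPlaqFibreMinimiser
import Summits.QuantumFields.YangMills.Theorems.UnitScaleTiltProp8EulerLagrangeCarrier
import Summits.QuantumFields.YangMills.Theorems.UnitScaleTiltProp8EulerLagrangeDeriv
import HarnessLib

/-!
# Route `UnitScaleTilt`, crux K1 child «MinimiserStabilityRegPr» (stmt-QuantumFields-19200), skeleton v10, stub `stub_existenceMinimalOrbit` on route (β) —
# THE EULER–LAGRANGE JUNCTION FOR CLOSED-FIBRE MINIMISERS THAT ARE INTERIOR: a minimiser of the Wilson action over the PLAQUETTE-ONLY closed fibre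
# `(6̄ₚ)(e) ∩ 𝔅_k(V)` whose plaquette variables are STRICTLY inside the shell satisfies the FULL (two-sided) Euler–Lagrange equation `Lin_Ū(ξ) = 0` along
# every differentiable curve of the fibre through it — NO Karush–Kuhn–Tucker multipliers; likewise for the two-clause closed fibre `(6̄)(e)` at a minimiser in `𝔘_k(e)`

Cell `ym3-torus`, width seat `ym-ust-19200-w4` (gen 0; INTERIOR-sentence owner on route (β), OWNER 2026-08-28 01:18:38Z; memo `INTERIOR-ANALYSIS-w4-g0.md` §5).
THEOREMS ONLY (0 `def`, 0 `sorry`).  YM₃ on T³ is a ladder rung (R3), not the Clay problem; nothing here claims the stub, the crux, d = 4 or the mass gap.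

WHY.  On route (β) the interiority sentence is split into a PLAQUETTE half and a DIVERGENCE half (`Prop7ClosedFibreInteriorAtR`, `Prop7ClosedFibreInteriorSplit`).
A Karush–Kuhn–Tucker treatment of a minimiser SITTING ON the shell meets unbounded multipliers (re-weighted action `Σ_p (1+4μ_p)A_p`).  But over 20520-w4's
plaquette-only closed fibre `(6̄ₚ)(e) = {∀ p, |U(∂p) − 1| ≤ eL^{−2(K−n)}} ∩ 𝔅_k(V)` (`Prop7ClosedPlaqFibreMinimiser`, p593040) the ONLY inequality constraints are the
plaquette ones, so once the plaquette half holds at a minimiser `Ū` (every `|Ū(∂p) − 1|` STRICTLY below the shell) the constraint set is a neighbourhood of `Ū`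
INSIDE THE FIBRE: every differentiable curve `γ` of the fibre through `Ū` stays in `(6̄ₚ)(e)` for small `|t|` (plaquette variables are continuous in the bonds,
`Prop8Criticality.continuous_coe_plaqHol`), and the cell's Euler–Lagrange theorem along differentiable curves (`Prop8Criticality.lin_eq_zero_of_isMinOn_of_hasDerivAt`,
p2∕w1 lineage, [Balaban1985Variational] (127), (158)) gives `Lin_Ū(ξ) = 0` for the velocity `ξ` — the equation (158) WITHOUT a sign condition and without
multipliers.  This is the junction the cleaner (β) architecture consumes: EX ⇐ hPlₚ (plaquette interiority over `(6̄ₚ)`) ∧ a bound on the fibre current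
`J = D*_Ū F` ∧ halving for E–L-critical configurations (memo §5).

WHAT IS PROVED (ns `…Theorems.Prop7ClosedFibreEulerLagrange`; any member `F`, `n ≤ K`, radius `e`, datum `V`).
* `continuousAt_cfg_of_differentiableAt` — a bondwise-differentiable curve of configurations is continuous at `0` in the product topology.
* `eventually_mem_closedPlaqFibre_of_plaqInterior` — along such a curve through a plaquette-interior `Ū`, lying in the fibre near `0`, the configurations stay in
  `(6̄ₚ)(e) ∩ 𝔅_k(V)` near `0`.
* ★ `lin_eq_zero_of_isMinOn_closedPlaqFibre_of_plaqInterior` — THE E–L EQUATION at a plaquette-interior minimiser over `(6̄ₚ)(e) ∩ 𝔅_k(V)`, along every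
  differentiable fibre curve (conclusion VERBATIM the `Lin` of `Prop8Criticality.lin_eq_zero_of_isMinOn_of_hasDerivAt`).
* `lin_eq_zero_of_isMinOn_closedRegFibre_of_interior` — the same over the two-clause closed fibre `(6̄)(e) ∩ 𝔅_k(V)` at a minimiser in the open class `𝔘_k(e)`
  (`Prop8Criticality.exists_ball_subset_regPr`).

HONEST SCOPE.  Topology + the cell's E–L theorem by name; no estimate; the plaquette half, the current bound and the halving are NOT touched here; nothing of
[Balaban1985Variational] is asserted; `--supports stmt-QuantumFields-19200`, count-neutral.

References: T. Bałaban, CMP 102 (1985) 277–309 [Balaban1985Variational] ((2), (5)–(6) p.278, (127) p.297, (158) p.302, Prop. 8 p.304).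
-/

set_option autoImplicit false

noncomputable section

namespace Summit.QuantumFields.YangMills.Theorems.Prop7ClosedFibreEulerLagrange

open Set Filter Topology
open scoped Matrix.Norms.L2Operator Matrix
open Literature.MathematicalPhysics.QuantumFieldTheory.Balaban1983to89
open Literature.MathematicalPhysics.QuantumFieldTheory.Balaban1983to89.T3ContinuumYM3Torus
open Literature.MathematicalPhysics.QuantumFieldTheory.Balaban1983to89.T3UnitLawDensityEML (ℰp)
open Literature.MathematicalPhysics.QuantumFieldTheory.Balaban1983to89.T3PrintedRegularMinimiser (RegPr DivSmall regFibrePr mem_regFibrePr_iff)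
open Literature.MathematicalPhysics.QuantumFieldTheory.Balaban1983to89.T3RegularMinimiser (regThreshold)
open Literature.MathematicalPhysics.QuantumFieldTheory.Balaban1983to89.T3ConstrainedMinimiser (fibre)
open Literature.MathematicalPhysics.QuantumFieldTheory.Balaban1983to89.T3TiltDescent (descendTo)
open Literature.MathematicalPhysics.QuantumFieldTheory.Balaban1983to89.B10Eq27TorusAxialLog (toUField unitsField)
open Literature.MathematicalPhysics.QuantumFieldTheory.Balaban1983to89.B10Eq68TorusRegularity (covDivT)
open Summit.QuantumFields.YangMills.Theorems.Prop8Criticality (continuous_coe_plaqHol exists_ball_subset_regPr lin_eq_zero_of_isMinOn_of_hasDerivAt)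
open Summit.QuantumFields.YangMills.Theorems.Prop7ClosedFibreMinimiser (regFibrePr_subset_closedRegFibre)

variable (F : T3Family) {n K : ℕ} (h : n ≤ K)

/-! ## §1 Curves: bondwise differentiability ⇒ continuity in the product topology; plaquette-interior points have fibre-neighbourhoods in `(6̄ₚ)(e)` -/

/-- A curve of `SU(2)` configurations whose every bond coordinate (read in `M₂(ℂ)`) is differentiable at `0` is continuous at `0` in the product topology. [folklore] -/
theorem continuousAt_cfg_of_differentiableAt {γ : ℝ → GaugeField (F.P K) 0 (Matrix.specialUnitaryGroup (Fin 2) ℂ)}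
    (hγdiff : ∀ b : PBond (F.P K) 0, DifferentiableAt ℝ (fun t : ℝ => (γ t b : Matrix (Fin 2) (Fin 2) ℂ)) 0) :
    ContinuousAt γ 0 := by
  refine continuousAt_pi.2 fun b => ?_
  exact Topology.IsInducing.subtypeVal.continuousAt_iff.2 (hγdiff b).continuousAt

/-- **A PLAQUETTE-INTERIOR POINT HAS A FIBRE-NEIGHBOURHOOD IN `(6̄ₚ)(e)`**: if `|Ū(∂p) − 1| < eL^{−2(K−n)}` for every plaquette (`PlaqSmall (regThreshold F n K e) Ū`) and
`γ` is a bondwise-differentiable curve with `γ(0) = Ū` lying in the descent fibre of `V` near `0`, then `γ(t) ∈ (6̄ₚ)(e) ∩ 𝔅_k(V)` for `t` near `0` (the strict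
sublevel set of the finitely many continuous plaquette deviations is open). [cite: Balaban1985Variational, (2), (6) p.278] -/
theorem eventually_mem_closedPlaqFibre_of_plaqInterior {e : ℝ} {V : GaugeField (F.P n) 0 (Matrix.specialUnitaryGroup (Fin 2) ℂ)}
    {Ū : GaugeField (F.P K) 0 (Matrix.specialUnitaryGroup (Fin 2) ℂ)} (hint : PlaqSmall (regThreshold F n K e) Ū)
    {γ : ℝ → GaugeField (F.P K) 0 (Matrix.specialUnitaryGroup (Fin 2) ℂ)} (hγ0 : γ 0 = Ū)
    (hγdiff : ∀ b : PBond (F.P K) 0, DifferentiableAt ℝ (fun t : ℝ => (γ t b : Matrix (Fin 2) (Fin 2) ℂ)) 0)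
    (hγfib : ∀ᶠ t in 𝓝 (0 : ℝ), γ t ∈ fibre F ℰp n K h V) :
    ∀ᶠ t in 𝓝 (0 : ℝ), γ t ∈ {U : GaugeField (F.P K) 0 (Matrix.specialUnitaryGroup (Fin 2) ℂ) | ∀ p : Plaq (F.P K) 0,
        GaugeGroup.dist1 (GaugeField.plaqHol U p) ≤ regThreshold F n K e} ∩ descendTo F ℰp n K h ⁻¹' {V} := by
  -- the open strict sublevel set of the plaquette deviations
  set O : Set (GaugeField (F.P K) 0 (Matrix.specialUnitaryGroup (Fin 2) ℂ)) :=
    ⋂ p : Plaq (F.P K) 0, {U | ‖((GaugeField.plaqHol U p : Matrix.specialUnitaryGroup (Fin 2) ℂ) : Matrix (Fin 2) (Fin 2) ℂ) - 1‖ < regThreshold F n K e}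
    with hO
  have hOopen : IsOpen O :=
    isOpen_iInter_of_finite fun p => isOpen_lt ((continuous_coe_plaqHol p).sub continuous_const).norm continuous_const
  have hŪO : Ū ∈ O := by
    simp only [hO, Set.mem_iInter, Set.mem_setOf_eq]
    intro p
    have := hint p
    rwa [SU2Mean.dist1_eq_norm] at this
  have hγO : ∀ᶠ t in 𝓝 (0 : ℝ), γ t ∈ O := by
    have hc : ContinuousAt γ 0 := continuousAt_cfg_of_differentiableAt F hγdiff
    have hmem : O ∈ 𝓝 (γ 0) := by rw [hγ0]; exact hOopen.mem_nhds hŪO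
    exact hc.preimage_mem_nhds hmem
  filter_upwards [hγO, hγfib] with t htO htfib
  refine ⟨fun p => ?_, htfib⟩
  have hp := (Set.mem_iInter.mp htO) p
  rw [Set.mem_setOf_eq] at hp
  rw [SU2Mean.dist1_eq_norm]
  exact hp.le

/-! ## §2 ★ The Euler–Lagrange equation at interior closed-fibre minimisers (two-sided, multiplier-free) -/

/-- ★ **THE EULER–LAGRANGE EQUATION AT A PLAQUETTE-INTERIOR MINIMISER OVER THE PLAQUETTE-ONLY CLOSED FIBRE.**  If `Ū` minimises the Wilson action over
`(6̄ₚ)(e) ∩ 𝔅_k(V)` and its plaquette variables are STRICTLY inside the shell (`PlaqSmall (regThreshold F n K e) Ū` — the plaquette half of the interiority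
sentence), then along every bondwise-differentiable curve `γ` of the fibre through `Ū` with velocity `ξ(b) = (d/dt)|₀ γ(t)(b)Ū(b)^*` the first variation vanishes:
`Lin_Ū(ξ) = 0` — print's (158) as an EQUATION, no Karush–Kuhn–Tucker sign, because `(6̄ₚ)(e)` is a fibre-neighbourhood of `Ū` (§1) and the cell's E–L theorem
along differentiable curves applies. [cite: Balaban1985Variational, (158) p.302, (127) p.297, (5)-(6) p.278] -/
theorem lin_eq_zero_of_isMinOn_closedPlaqFibre_of_plaqInterior {e : ℝ} {V : GaugeField (F.P n) 0 (Matrix.specialUnitaryGroup (Fin 2) ℂ)}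
    {Ū : GaugeField (F.P K) 0 (Matrix.specialUnitaryGroup (Fin 2) ℂ)}
    (hmin : IsMinOn (fun W : GaugeField (F.P K) 0 (Matrix.specialUnitaryGroup (Fin 2) ℂ) => wilsonAction4 W)
      ({U : GaugeField (F.P K) 0 (Matrix.specialUnitaryGroup (Fin 2) ℂ) | ∀ p : Plaq (F.P K) 0,
          GaugeGroup.dist1 (GaugeField.plaqHol U p) ≤ regThreshold F n K e} ∩ descendTo F ℰp n K h ⁻¹' {V}) Ū)
    (hint : PlaqSmall (regThreshold F n K e) Ū)
    (γ : ℝ → GaugeField (F.P K) 0 (Matrix.specialUnitaryGroup (Fin 2) ℂ)) (hγ0 : γ 0 = Ū)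
    (hγdiff : ∀ b : PBond (F.P K) 0, DifferentiableAt ℝ (fun t : ℝ => (γ t b : Matrix (Fin 2) (Fin 2) ℂ)) 0)
    (hγfib : ∀ᶠ t in 𝓝 (0 : ℝ), γ t ∈ fibre F ℰp n K h V)
    (ξ : PBond (F.P K) 0 → Matrix (Fin 2) (Fin 2) ℂ)
    (hγξ : ∀ b : PBond (F.P K) 0,
      HasDerivAt (fun t : ℝ => (γ t b : Matrix (Fin 2) (Fin 2) ℂ) * star (Ū b : Matrix (Fin 2) (Fin 2) ℂ)) (ξ b) 0) :
    ∑ p : Plaq (F.P K) 0, (1 / 2) * ((((((GaugeField.plaqHol Ū p : Matrix.specialUnitaryGroup (Fin 2) ℂ) : Matrix (Fin 2) (Fin 2) ℂ)) - 1)ᴴ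
          * ((ξ ⟨p.src, p.μ⟩
              + (Ū ⟨p.src, p.μ⟩ : Matrix (Fin 2) (Fin 2) ℂ) * ξ ⟨p.src.shift p.μ, p.ν⟩ * star (Ū ⟨p.src, p.μ⟩ : Matrix (Fin 2) (Fin 2) ℂ)
              - ((Ū ⟨p.src, p.μ⟩ * Ū ⟨p.src.shift p.μ, p.ν⟩ * (Ū ⟨p.src.shift p.ν, p.μ⟩)⁻¹ : Matrix.specialUnitaryGroup (Fin 2) ℂ) : Matrix (Fin 2) (Fin 2) ℂ)
                  * ξ ⟨p.src.shift p.ν, p.μ⟩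
                  * star ((Ū ⟨p.src, p.μ⟩ * Ū ⟨p.src.shift p.μ, p.ν⟩ * (Ū ⟨p.src.shift p.ν, p.μ⟩)⁻¹ : Matrix.specialUnitaryGroup (Fin 2) ℂ) : Matrix (Fin 2) (Fin 2) ℂ)
              - ((GaugeField.plaqHol Ū p : Matrix.specialUnitaryGroup (Fin 2) ℂ) : Matrix (Fin 2) (Fin 2) ℂ) * ξ ⟨p.src, p.ν⟩
                  * star ((GaugeField.plaqHol Ū p : Matrix.specialUnitaryGroup (Fin 2) ℂ) : Matrix (Fin 2) (Fin 2) ℂ))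
            * ((GaugeField.plaqHol Ū p : Matrix.specialUnitaryGroup (Fin 2) ℂ) : Matrix (Fin 2) (Fin 2) ℂ))).trace).re = 0 :=
  lin_eq_zero_of_isMinOn_of_hasDerivAt hmin γ (eventually_mem_closedPlaqFibre_of_plaqInterior F h hint hγ0 hγdiff hγfib) hγ0 ξ hγξ

/-- **THE SAME OVER THE TWO-CLAUSE CLOSED FIBRE `(6̄)(e) ∩ 𝔅_k(V)` AT A MINIMISER IN THE OPEN CLASS `𝔘_k(e)`** (both clauses of (2) strict at `Ū`, i.e. the full
interiority sentence at `Ū`): `𝔘_k(e)` is open in the bonds (`Prop8Criticality.exists_ball_subset_regPr`), so a differentiable fibre curve through `Ū` stays in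
`(6)(e) ⊆ (6̄)(e)` near `0` and `Lin_Ū(ξ) = 0`. [cite: Balaban1985Variational, (158) p.302, (2), (6) p.278] -/
theorem lin_eq_zero_of_isMinOn_closedRegFibre_of_interior {e : ℝ} {V : GaugeField (F.P n) 0 (Matrix.specialUnitaryGroup (Fin 2) ℂ)}
    {Ū : GaugeField (F.P K) 0 (Matrix.specialUnitaryGroup (Fin 2) ℂ)}
    (hmin : IsMinOn (fun W : GaugeField (F.P K) 0 (Matrix.specialUnitaryGroup (Fin 2) ℂ) => wilsonAction4 W)
      ({U : GaugeField (F.P K) 0 (Matrix.specialUnitaryGroup (Fin 2) ℂ) | ∀ p : Plaq (F.P K) 0,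
          GaugeGroup.dist1 (GaugeField.plaqHol U p) ≤ regThreshold F n K e} ∩ descendTo F ℰp n K h ⁻¹' {V} ∩
        {U | ∀ b : PBond (F.P K) 0, ‖covDivT 1 (unitsField (toUField U)) b.dir b.src‖ ≤ e * ((F.L : ℝ)⁻¹) ^ (3 * (K - n))}) Ū)
    (hint : RegPr F n K e Ū)
    (γ : ℝ → GaugeField (F.P K) 0 (Matrix.specialUnitaryGroup (Fin 2) ℂ)) (hγ0 : γ 0 = Ū)
    (hγdiff : ∀ b : PBond (F.P K) 0, DifferentiableAt ℝ (fun t : ℝ => (γ t b : Matrix (Fin 2) (Fin 2) ℂ)) 0)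
    (hγfib : ∀ᶠ t in 𝓝 (0 : ℝ), γ t ∈ fibre F ℰp n K h V)
    (ξ : PBond (F.P K) 0 → Matrix (Fin 2) (Fin 2) ℂ)
    (hγξ : ∀ b : PBond (F.P K) 0,
      HasDerivAt (fun t : ℝ => (γ t b : Matrix (Fin 2) (Fin 2) ℂ) * star (Ū b : Matrix (Fin 2) (Fin 2) ℂ)) (ξ b) 0) :
    ∑ p : Plaq (F.P K) 0, (1 / 2) * ((((((GaugeField.plaqHol Ū p : Matrix.specialUnitaryGroup (Fin 2) ℂ) : Matrix (Fin 2) (Fin 2) ℂ)) - 1)ᴴ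
          * ((ξ ⟨p.src, p.μ⟩
              + (Ū ⟨p.src, p.μ⟩ : Matrix (Fin 2) (Fin 2) ℂ) * ξ ⟨p.src.shift p.μ, p.ν⟩ * star (Ū ⟨p.src, p.μ⟩ : Matrix (Fin 2) (Fin 2) ℂ)
              - ((Ū ⟨p.src, p.μ⟩ * Ū ⟨p.src.shift p.μ, p.ν⟩ * (Ū ⟨p.src.shift p.ν, p.μ⟩)⁻¹ : Matrix.specialUnitaryGroup (Fin 2) ℂ) : Matrix (Fin 2) (Fin 2) ℂ)
                  * ξ ⟨p.src.shift p.ν, p.μ⟩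
                  * star ((Ū ⟨p.src, p.μ⟩ * Ū ⟨p.src.shift p.μ, p.ν⟩ * (Ū ⟨p.src.shift p.ν, p.μ⟩)⁻¹ : Matrix.specialUnitaryGroup (Fin 2) ℂ) : Matrix (Fin 2) (Fin 2) ℂ)
              - ((GaugeField.plaqHol Ū p : Matrix.specialUnitaryGroup (Fin 2) ℂ) : Matrix (Fin 2) (Fin 2) ℂ) * ξ ⟨p.src, p.ν⟩
                  * star ((GaugeField.plaqHol Ū p : Matrix.specialUnitaryGroup (Fin 2) ℂ) : Matrix (Fin 2) (Fin 2) ℂ))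
            * ((GaugeField.plaqHol Ū p : Matrix.specialUnitaryGroup (Fin 2) ℂ) : Matrix (Fin 2) (Fin 2) ℂ))).trace).re = 0 := by
  -- `𝔘_k(e)` is open in the bonds: a ball around `Ū` inside it
  obtain ⟨δ, hδ, hball⟩ := exists_ball_subset_regPr F n K e Ū hint
  have hnear : ∀ b : PBond (F.P K) 0, ∀ᶠ t in 𝓝 (0 : ℝ),
      ‖((γ t b : Matrix.specialUnitaryGroup (Fin 2) ℂ) : Matrix (Fin 2) (Fin 2) ℂ) - (Ū b : Matrix (Fin 2) (Fin 2) ℂ)‖ < δ := by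
    intro b
    have h1 : Tendsto (fun t : ℝ => ((γ t b : Matrix.specialUnitaryGroup (Fin 2) ℂ) : Matrix (Fin 2) (Fin 2) ℂ)) (𝓝 0)
        (𝓝 ((Ū b : Matrix.specialUnitaryGroup (Fin 2) ℂ) : Matrix (Fin 2) (Fin 2) ℂ)) := by
      have := (hγdiff b).continuousAt.tendsto
      rwa [hγ0] at this
    filter_upwards [h1 (Metric.ball_mem_nhds _ hδ)] with t ht
    rwa [Set.mem_preimage, Metric.mem_ball, dist_eq_norm] at ht
  -- hence the curve stays in `(6)(e) ⊆ (6̄)(e)` near `0`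
  have hγS : ∀ᶠ t in 𝓝 (0 : ℝ), γ t ∈ {U : GaugeField (F.P K) 0 (Matrix.specialUnitaryGroup (Fin 2) ℂ) | ∀ p : Plaq (F.P K) 0,
          GaugeGroup.dist1 (GaugeField.plaqHol U p) ≤ regThreshold F n K e} ∩ descendTo F ℰp n K h ⁻¹' {V} ∩
        {U | ∀ b : PBond (F.P K) 0, ‖covDivT 1 (unitsField (toUField U)) b.dir b.src‖ ≤ e * ((F.L : ℝ)⁻¹) ^ (3 * (K - n))} := by
    filter_upwards [hγfib, Filter.eventually_all.mpr hnear] with t htfib hdist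
    exact regFibrePr_subset_closedRegFibre F h e V ((mem_regFibrePr_iff F).2 ⟨htfib, hball (γ t) hdist⟩)
  exact lin_eq_zero_of_isMinOn_of_hasDerivAt hmin γ hγS hγ0 ξ hγξ

/-! ## §3 The same in the `deriv`/`IsLocalMin` reading of route (α)'s E–L schema (w2 `Prop7CritEL`: curves IN the fibre, continuous at `0`) -/

/-- **LOCAL MINIMUM ALONG FIBRE-VALUED CURVES AT A PLAQUETTE-INTERIOR MINIMISER OVER `(6̄ₚ)(e) ∩ 𝔅_k(V)`**: if `Ū` minimises the Wilson action over the plaquette-only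
closed fibre and its plaquette variables are strictly inside the shell, then along every curve `γ` in the fibre `𝔅_k(V)` with `γ 0 = Ū`, continuous at `0`, `t ↦ A(γ t)` has a
local minimum at `0` (the strict plaquette sublevel set is an open neighbourhood of `Ū`).  This is the hypothesis-side of route (α)'s def-free E–L schema
(`Prop7CritEL.isLocalMin_comp_of_isCritR2` for R2-critical points) at the closed-fibre minimisers of route (β′). [cite: Balaban1985Variational, (5)-(6) p.278, (111) p.294, p.300] -/
theorem isLocalMin_comp_of_isMinOn_closedPlaqFibre_of_plaqInterior {e : ℝ} {V : GaugeField (F.P n) 0 (Matrix.specialUnitaryGroup (Fin 2) ℂ)}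
    {Ū : GaugeField (F.P K) 0 (Matrix.specialUnitaryGroup (Fin 2) ℂ)}
    (hmin : IsMinOn (fun W : GaugeField (F.P K) 0 (Matrix.specialUnitaryGroup (Fin 2) ℂ) => wilsonAction4 W)
      ({U : GaugeField (F.P K) 0 (Matrix.specialUnitaryGroup (Fin 2) ℂ) | ∀ p : Plaq (F.P K) 0,
          GaugeGroup.dist1 (GaugeField.plaqHol U p) ≤ regThreshold F n K e} ∩ descendTo F ℰp n K h ⁻¹' {V}) Ū)
    (hint : PlaqSmall (regThreshold F n K e) Ū)
    (γ : ℝ → GaugeField (F.P K) 0 (Matrix.specialUnitaryGroup (Fin 2) ℂ)) (hγ0 : γ 0 = Ū) (hγfib : ∀ t, γ t ∈ fibre F ℰp n K h V)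
    (hγc : ContinuousAt γ 0) :
    IsLocalMin (fun t => wilsonAction4 (γ t)) 0 := by
  set O : Set (GaugeField (F.P K) 0 (Matrix.specialUnitaryGroup (Fin 2) ℂ)) :=
    ⋂ p : Plaq (F.P K) 0, {U | ‖((GaugeField.plaqHol U p : Matrix.specialUnitaryGroup (Fin 2) ℂ) : Matrix (Fin 2) (Fin 2) ℂ) - 1‖ < regThreshold F n K e}
    with hO
  have hOopen : IsOpen O :=
    isOpen_iInter_of_finite fun p => isOpen_lt ((continuous_coe_plaqHol p).sub continuous_const).norm continuous_const
  have hŪO : Ū ∈ O := by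
    simp only [hO, Set.mem_iInter, Set.mem_setOf_eq]
    intro p
    have := hint p
    rwa [SU2Mean.dist1_eq_norm] at this
  have hγO : ∀ᶠ t in 𝓝 (0 : ℝ), γ t ∈ O := by
    have hmem : O ∈ 𝓝 (γ 0) := by rw [hγ0]; exact hOopen.mem_nhds hŪO
    exact hγc.preimage_mem_nhds hmem
  show ∀ᶠ t in 𝓝 (0 : ℝ), wilsonAction4 (γ 0) ≤ wilsonAction4 (γ t)
  filter_upwards [hγO] with t htO
  rw [hγ0]
  refine hmin ⟨fun p => ?_, hγfib t⟩
  have hp := (Set.mem_iInter.mp htO) p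
  rw [Set.mem_setOf_eq] at hp
  rw [SU2Mean.dist1_eq_norm]
  exact hp.le

/-- **… HENCE `deriv (A ∘ γ) 0 = 0` (Fermat)** — route (α)'s def-free Euler–Lagrange schema «EL(V, Ū)» (w2 `Prop7ExistRouteAlpha`: every fibre-valued curve through `Ū`,
bondwise differentiable at `0`, has `deriv (A ∘ γ) 0 = 0`) HOLDS at every plaquette-interior minimiser over `(6̄ₚ)(e) ∩ 𝔅_k(V)`: routes (α) and (β′) share ONE E–L notion.
[cite: Balaban1985Variational, (111) p.294, (158) p.302] -/
theorem deriv_comp_eq_zero_of_isMinOn_closedPlaqFibre_of_plaqInterior {e : ℝ} {V : GaugeField (F.P n) 0 (Matrix.specialUnitaryGroup (Fin 2) ℂ)}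
    {Ū : GaugeField (F.P K) 0 (Matrix.specialUnitaryGroup (Fin 2) ℂ)}
    (hmin : IsMinOn (fun W : GaugeField (F.P K) 0 (Matrix.specialUnitaryGroup (Fin 2) ℂ) => wilsonAction4 W)
      ({U : GaugeField (F.P K) 0 (Matrix.specialUnitaryGroup (Fin 2) ℂ) | ∀ p : Plaq (F.P K) 0,
          GaugeGroup.dist1 (GaugeField.plaqHol U p) ≤ regThreshold F n K e} ∩ descendTo F ℰp n K h ⁻¹' {V}) Ū)
    (hint : PlaqSmall (regThreshold F n K e) Ū)
    (γ : ℝ → GaugeField (F.P K) 0 (Matrix.specialUnitaryGroup (Fin 2) ℂ)) (hγ0 : γ 0 = Ū) (hγfib : ∀ t, γ t ∈ fibre F ℰp n K h V)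
    (hγdiff : ∀ b : PBond (F.P K) 0, DifferentiableAt ℝ (fun t : ℝ => (γ t b : Matrix (Fin 2) (Fin 2) ℂ)) 0) :
    deriv (fun t => wilsonAction4 (γ t)) 0 = 0 :=
  (isLocalMin_comp_of_isMinOn_closedPlaqFibre_of_plaqInterior F h hmin hint γ hγ0 hγfib (continuousAt_cfg_of_differentiableAt F hγdiff)).deriv_eq_zero

/-- The two-clause twin: a minimiser over `(6̄)(e) ∩ 𝔅_k(V)` lying in the open class `𝔘_k(e)` is a local minimum of `A` along every fibre-valued curve through it that is
continuous at `0` (`𝔘_k(e)` open in the bonds, `Prop8Criticality.exists_ball_subset_regPr`). [cite: Balaban1985Variational, (2), (5)-(6) p.278, p.300] -/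
theorem isLocalMin_comp_of_isMinOn_closedRegFibre_of_interior {e : ℝ} {V : GaugeField (F.P n) 0 (Matrix.specialUnitaryGroup (Fin 2) ℂ)}
    {Ū : GaugeField (F.P K) 0 (Matrix.specialUnitaryGroup (Fin 2) ℂ)}
    (hmin : IsMinOn (fun W : GaugeField (F.P K) 0 (Matrix.specialUnitaryGroup (Fin 2) ℂ) => wilsonAction4 W)
      ({U : GaugeField (F.P K) 0 (Matrix.specialUnitaryGroup (Fin 2) ℂ) | ∀ p : Plaq (F.P K) 0,
          GaugeGroup.dist1 (GaugeField.plaqHol U p) ≤ regThreshold F n K e} ∩ descendTo F ℰp n K h ⁻¹' {V} ∩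
        {U | ∀ b : PBond (F.P K) 0, ‖covDivT 1 (unitsField (toUField U)) b.dir b.src‖ ≤ e * ((F.L : ℝ)⁻¹) ^ (3 * (K - n))}) Ū)
    (hint : RegPr F n K e Ū)
    (γ : ℝ → GaugeField (F.P K) 0 (Matrix.specialUnitaryGroup (Fin 2) ℂ)) (hγ0 : γ 0 = Ū) (hγfib : ∀ t, γ t ∈ fibre F ℰp n K h V)
    (hγc : ContinuousAt γ 0) :
    IsLocalMin (fun t => wilsonAction4 (γ t)) 0 := by
  obtain ⟨δ, hδ, hball⟩ := exists_ball_subset_regPr F n K e Ū hint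
  -- bondwise closeness along the (continuous) curve
  have hnear : ∀ b : PBond (F.P K) 0, ∀ᶠ t in 𝓝 (0 : ℝ),
      ‖((γ t b : Matrix.specialUnitaryGroup (Fin 2) ℂ) : Matrix (Fin 2) (Fin 2) ℂ) - (Ū b : Matrix (Fin 2) (Fin 2) ℂ)‖ < δ := by
    intro b
    have hcb : ContinuousAt (fun t : ℝ => ((γ t b : Matrix.specialUnitaryGroup (Fin 2) ℂ) : Matrix (Fin 2) (Fin 2) ℂ)) 0 :=
      Topology.IsInducing.subtypeVal.continuousAt_iff.1 ((continuousAt_pi.1 hγc) b)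
    have h1 : Tendsto (fun t : ℝ => ((γ t b : Matrix.specialUnitaryGroup (Fin 2) ℂ) : Matrix (Fin 2) (Fin 2) ℂ)) (𝓝 0)
        (𝓝 ((Ū b : Matrix.specialUnitaryGroup (Fin 2) ℂ) : Matrix (Fin 2) (Fin 2) ℂ)) := by
      have := hcb.tendsto
      rwa [hγ0] at this
    filter_upwards [h1 (Metric.ball_mem_nhds _ hδ)] with t ht
    rwa [Set.mem_preimage, Metric.mem_ball, dist_eq_norm] at ht
  show ∀ᶠ t in 𝓝 (0 : ℝ), wilsonAction4 (γ 0) ≤ wilsonAction4 (γ t)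
  filter_upwards [Filter.eventually_all.mpr hnear] with t hdist
  rw [hγ0]
  exact hmin (regFibrePr_subset_closedRegFibre F h e V ((mem_regFibrePr_iff F).2 ⟨hγfib t, hball (γ t) hdist⟩))

/-- … and `deriv (A ∘ γ) 0 = 0` there (Fermat). [cite: Balaban1985Variational, (111) p.294, (158) p.302] -/
theorem deriv_comp_eq_zero_of_isMinOn_closedRegFibre_of_interior {e : ℝ} {V : GaugeField (F.P n) 0 (Matrix.specialUnitaryGroup (Fin 2) ℂ)}
    {Ū : GaugeField (F.P K) 0 (Matrix.specialUnitaryGroup (Fin 2) ℂ)}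
    (hmin : IsMinOn (fun W : GaugeField (F.P K) 0 (Matrix.specialUnitaryGroup (Fin 2) ℂ) => wilsonAction4 W)
      ({U : GaugeField (F.P K) 0 (Matrix.specialUnitaryGroup (Fin 2) ℂ) | ∀ p : Plaq (F.P K) 0,
          GaugeGroup.dist1 (GaugeField.plaqHol U p) ≤ regThreshold F n K e} ∩ descendTo F ℰp n K h ⁻¹' {V} ∩
        {U | ∀ b : PBond (F.P K) 0, ‖covDivT 1 (unitsField (toUField U)) b.dir b.src‖ ≤ e * ((F.L : ℝ)⁻¹) ^ (3 * (K - n))}) Ū)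
    (hint : RegPr F n K e Ū)
    (γ : ℝ → GaugeField (F.P K) 0 (Matrix.specialUnitaryGroup (Fin 2) ℂ)) (hγ0 : γ 0 = Ū) (hγfib : ∀ t, γ t ∈ fibre F ℰp n K h V)
    (hγdiff : ∀ b : PBond (F.P K) 0, DifferentiableAt ℝ (fun t : ℝ => (γ t b : Matrix (Fin 2) (Fin 2) ℂ)) 0) :
    deriv (fun t => wilsonAction4 (γ t)) 0 = 0 :=
  (isLocalMin_comp_of_isMinOn_closedRegFibre_of_interior F h hmin hint γ hγ0 hγfib (continuousAt_cfg_of_differentiableAt F hγdiff)).deriv_eq_zero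

end Summit.QuantumFields.YangMills.Theorems.Prop7ClosedFibreEulerLagrange

end
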